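import Summits.ResolutionOfSingularities.ResolutionOfSingularities.Theorems.PurelyInseparableDim4ResConeCInfSharpEntryCoreSigma
import Summits.ResolutionOfSingularities.ResolutionOfSingularities.Theorems.PurelyInseparableDim4ResConeCInfKillersSigma
import HarnessLib
import HarnessLib.Audit.Tags

/-!
# Purely inseparable four-folds — THE σ-♯-CHAIN, every σ = (n, n) + 0 and every prime: inside one finite translated slot chain IN REGIME, from two
# steps after ANY letter change on every state has SLOTS, the σ-LEDGER, REGIME R and LAYER, provided a second letter change comes later — the
# `1 ↦ n` edition of FILE ♯8-chain `…ResConeCInfSharpChainPrime` WITHOUT the ♯-flag conjunct (cell `res-dim4-pi`, K2(p) lane, class (iii) rows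
# σ = (n, n) + 0, flagless branch, FILE ♯8-chainσ)

[OURS · counted 0 · cell `res-dim4-pi` · K2(p) lane (holder res-dim4-p-12 g5, ruling g5-33 «(σ♭)»; res-dim4-p-3 g6's MEMO
`res-dim4-p-3/MEMO-g6-FLAGLESS-SHARP.md` §6 ♯8 and σ-allocation (bus 2026-08-29 16:00Z); typed by the width seat res-dim4-p-13 g6 by signature).]
Nothing here proves K2(p) for any `p`, any TAIL(p, d, 3), FLAGLESS♯, `NoIsolatedTrap p p`, the Cossart–Jannsen–Saito theorem or resolution of
singularities in dimension ≥ 4 / characteristic `p` — NOT proved.  AI kernel work, weaker than expert review.  Exponent algebra about OUR frame.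

SETTING (section letters `j i u f` pairwise `≠`; `n + d = p`, `2 ≤ d`): `(Bs : ℕ → State K) (ℓs : ℕ → Fin 4) (βs : ℕ → K) {T : ℕ}` with
`Bs (t+1) = step p univ (ℓs t) (update 0 u (βs t)) (Bs t)` for `t < T`, `ℓs t ∈ {j, i}` for all `t`, order `≥ p` along `univ` and IN REGIME
(every exponent of degree `≥ p + n + 1` or the cone `x_j^n x_i^n x_f^d`) for `t ≤ T`; at `t = 0`: SLOTS «`e_j, e_i ≥ n`», σ-LEDGER
«`e_f ≤ d − 1 ⇒ e_j, e_i ≥ n + 1`», σ-flag rows `coeff x_j^{n+1} x_i^{n+1} x_u^{d−1−c} x_f^c = 0` (`c + 2 ≤ d`).  For `n = 1` (`d + 1 = p`) every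
statement below is literally the corresponding statement of FILE ♯8-chain minus its ♯-flag conjunct.
* §1 `sharpEntry_step_either_sigma` — ♯8-coreσ `sharpEntry_step_sigma` for a step in either slot (mirror by `gameExp_swap`).
* §2 **`chain_base_sigma`** — SLOTS, the σ-ledger and σ-flaglessness hold at every `t ≤ T` (♯2σ ledger transport + ♯1σ flag invariance, both
  mirrored: σ-FLAGLESSNESS IS CHAIN-INVARIANT).
* §3 **`chain_nokill_sigma`** — KILLER EXCLUSION from a later letter change: if `ℓs t₀ = j` and some later step changes letter
  (`ℓs t₁ ≠ ℓs (t₁+1)`, `t₀ < t₁`, `t₁ + 2 ≤ T`), then `Bs (t₀+1)` carries no σ-`j`-killer (♯3σ: a killer forbids every later `j`-step and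
  survives every `i`-step, so `ℓs ≡ i` after `t₀ + 1`, contradicting the change at `t₁`).
* §4 **`sharp_chain_sigma`** (+ `sharp_chain_sigma_of_eq`, the case `ℓs t₀ = j`) — with a letter change at `t₀` and another at `t₁ > t₀`
  (`t₁ + 2 ≤ T`): for every `t` with `t₀ + 2 ≤ t`, `t + 1 ≤ T`, the state `Bs t` has SLOTS, the σ-LEDGER, REGIME R («`e_f + 2 ≤ d ⇒ e_j, e_i ≥ n + 2`»)
  and LAYER (♯8-coreσ START at `t₀` with §3's killer exclusion, then §1 inductively).
USE (res-dim4-p-3 g6's E5σ♭ / DICHOTOMYσ, next): regime R on the chain ⇒ `not_isIsolated_of_regimeR_of_le_five` kills the flagless branch of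
the (2,2)+0 / (3,3)+0 rows at `p = 7` with no window.
[cite: Hauser2010, §§F–G] [cite: CossartJannsenSaito2020, Thm. 3.14]
bears_on: LADDER-RESOLUTION:D157-DOOR2 (res-dim4-pi · K2(p) · power cones · class (iii) σ = (n,n)+0 flagless branch ♯8-chainσ).  Supports
stmt-ResolutionOfSingularities-16155 (helper).
-/

set_option linter.dupNamespace false -- mandated namespace of this single-conjunct summit

noncomputable section

namespace Summit.ResolutionOfSingularities.ResolutionOfSingularities.Theorems.PIDim4

namespace ResCone

open MvPolynomial Finset
open Literature.AlgebraicGeometry.Resolution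
open Literature.AlgebraicGeometry.Resolution.CentreBlowup
open Literature.AlgebraicGeometry.Resolution.Hauser2010
open Literature.AlgebraicGeometry.Resolution.HauserPerlega2019

variable {K : Type} [Field K] [DecidableEq K]

section Chain

variable {j i u f : Fin 4} (hji : j ≠ i) (hju : j ≠ u) (hjf : j ≠ f) (hiu : i ≠ u) (hif : i ≠ f) (huf : u ≠ f)
include hji hju hjf hiu hif huf

/-! ## 1. Propagation through a step in either slot -/

/-- **σ-♯-PROPAGATION, EITHER SLOT** (♯8-coreσ `sharpEntry_step_sigma` and its mirror): parent in regime with SLOTS, σ-LEDGER, REGIME R and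
LAYER; child `ℓ₀(β)` (`ℓ₀ ∈ {j, i}`); grandchild `ℓ(β′)` in regime ⇒ the child has SLOTS, σ-LEDGER, REGIME R and LAYER. [OURS]
[cite: Hauser2010, §§F–G] -/
theorem sharpEntry_step_either_sigma (p : ℕ) {n d : ℕ} (hσ : n + d = p) (hd2 : 2 ≤ d) (s : State K)
    (hq : ((p : ℕ) : ℕ∞) ≤ ordAlong Finset.univ s.F) (hr1 : ∀ e ∈ s.F.support, n ≤ e j ∧ n ≤ e i)
    (hreg : ∀ E ∈ s.F.support, p + n + 1 ≤ E.degree ∨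
      E = Finsupp.single j n + Finsupp.single i n + Finsupp.single u 0 + Finsupp.single f d)
    (hled : ∀ e ∈ s.F.support, e f ≤ d - 1 → n + 1 ≤ e j ∧ n + 1 ≤ e i)
    (hR : ∀ e ∈ s.F.support, e f + 2 ≤ d → n + 2 ≤ e j ∧ n + 2 ≤ e i)
    (hlayer : ∀ E : Fin 4 →₀ ℕ, E.degree = p + n + 1 → E f + 2 ≤ d → coeff E s.F = 0)
    {ℓ₀ : Fin 4} (hℓ₀ : ℓ₀ = j ∨ ℓ₀ = i) (β : K)
    (hq₁ : ((p : ℕ) : ℕ∞) ≤ ordAlong Finset.univ (CentreBlowup.step p Finset.univ ℓ₀ (Function.update (0 : Fin 4 → K) u β) s).F)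
    {ℓ : Fin 4} (hℓ : ℓ = j ∨ ℓ = i) (β' : K)
    (hreg₂ : ∀ E ∈ (CentreBlowup.step p Finset.univ ℓ (Function.update (0 : Fin 4 → K) u β')
        (CentreBlowup.step p Finset.univ ℓ₀ (Function.update (0 : Fin 4 → K) u β) s)).F.support,
      p + n + 1 ≤ E.degree ∨ E = Finsupp.single j n + Finsupp.single i n + Finsupp.single u 0 + Finsupp.single f d) :
    (∀ e ∈ (CentreBlowup.step p Finset.univ ℓ₀ (Function.update (0 : Fin 4 → K) u β) s).F.support, n ≤ e j ∧ n ≤ e i) ∧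
      (∀ e ∈ (CentreBlowup.step p Finset.univ ℓ₀ (Function.update (0 : Fin 4 → K) u β) s).F.support,
        e f ≤ d - 1 → n + 1 ≤ e j ∧ n + 1 ≤ e i) ∧
      (∀ e ∈ (CentreBlowup.step p Finset.univ ℓ₀ (Function.update (0 : Fin 4 → K) u β) s).F.support,
        e f + 2 ≤ d → n + 2 ≤ e j ∧ n + 2 ≤ e i) ∧
      (∀ E : Fin 4 →₀ ℕ, E.degree = p + n + 1 → E f + 2 ≤ d →
        coeff E (CentreBlowup.step p Finset.univ ℓ₀ (Function.update (0 : Fin 4 → K) u β) s).F = 0) := by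
  rcases hℓ₀ with h | h <;> rw [h] at hq₁ hreg₂ ⊢
  · exact sharpEntry_step_sigma hji hju hjf hiu hif huf p hσ hd2 s hq hr1 hreg hled hR hlayer β hq₁ hℓ β' hreg₂
  · have hcone : (Finsupp.single j n + Finsupp.single i n + Finsupp.single u 0 + Finsupp.single f d : Fin 4 →₀ ℕ) =
        Finsupp.single i n + Finsupp.single j n + Finsupp.single u 0 + Finsupp.single f d := gameExp_swap n n 0 d
    obtain ⟨h1, h2, h3, h4⟩ := sharpEntry_step_sigma hji.symm hiu hif hju hjf huf p hσ hd2 s hq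
      (fun e he => (hr1 e he).symm) (fun E hE => (hreg E hE).imp_right fun h => h.trans hcone)
      (fun e he hef => (hled e he hef).symm) (fun e he hef => (hR e he hef).symm) hlayer β hq₁ hℓ.symm β'
      (fun E hE => (hreg₂ E hE).imp_right fun h => h.trans hcone)
    exact ⟨fun e he => (h1 e he).symm, fun e he hef => (h2 e he hef).symm, fun e he hef => (h3 e he hef).symm, h4⟩

/-! ## 2. Base invariants along the chain -/

/-- **BASE INVARIANTS OF A TRANSLATED SLOT CHAIN, σ-edition** (module docstring §2): SLOTS, the σ-ledger and the absence of every σ-flag row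
propagate from `Bs 0` to every `Bs t`, `t ≤ T`. The `n = 1` case is FILE ♯8-chain's `chain_base_prime`. [OURS] [cite: Hauser2010, §§F–G] -/
theorem chain_base_sigma (p : ℕ) {n d : ℕ} (hσ : n + d = p) (hd2 : 2 ≤ d)
    (Bs : ℕ → State K) (ℓs : ℕ → Fin 4) (βs : ℕ → K) {T : ℕ}
    (hstep : ∀ t, t < T → Bs (t + 1) = CentreBlowup.step p Finset.univ (ℓs t) (Function.update (0 : Fin 4 → K) u (βs t)) (Bs t))
    (hℓ : ∀ t, ℓs t = j ∨ ℓs t = i)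
    (hq : ∀ t, t ≤ T → ((p : ℕ) : ℕ∞) ≤ ordAlong Finset.univ (Bs t).F)
    (hreg : ∀ t, t ≤ T → ∀ E ∈ (Bs t).F.support,
      p + n + 1 ≤ E.degree ∨ E = Finsupp.single j n + Finsupp.single i n + Finsupp.single u 0 + Finsupp.single f d)
    (hr1₀ : ∀ e ∈ (Bs 0).F.support, n ≤ e j ∧ n ≤ e i)
    (hled₀ : ∀ e ∈ (Bs 0).F.support, e f ≤ d - 1 → n + 1 ≤ e j ∧ n + 1 ≤ e i)
    (hflag₀ : ∀ c, c + 2 ≤ d →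
      coeff (Finsupp.single j (n + 1) + Finsupp.single i (n + 1) + Finsupp.single u (d - 1 - c) + Finsupp.single f c) (Bs 0).F = 0) :
    ∀ t, t ≤ T →
      (∀ e ∈ (Bs t).F.support, n ≤ e j ∧ n ≤ e i) ∧
        (∀ e ∈ (Bs t).F.support, e f ≤ d - 1 → n + 1 ≤ e j ∧ n + 1 ≤ e i) ∧
        (∀ c, c + 2 ≤ d →
          coeff (Finsupp.single j (n + 1) + Finsupp.single i (n + 1) + Finsupp.single u (d - 1 - c) + Finsupp.single f c)
            (Bs t).F = 0) := by
  intro t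
  induction t with
  | zero => exact fun _ => ⟨hr1₀, hled₀, hflag₀⟩
  | succ t ih =>
    intro ht
    obtain ⟨hr1, hled, hflag⟩ := ih (by omega)
    obtain ⟨h6, hstraight⟩ := h6_straight_of_reg_sigma hji hju hjf hiu hif huf hσ (hreg t (by omega))
    have hqt := hq t (by omega)
    rw [hstep t (by omega)]
    rcases hℓ t with hl | hl <;> rw [hl]
    · refine ⟨fun E hE => ?_,
        (ledger_degree_step_translate_u_sigma hji hju hjf hiu hif huf p hd2 (Bs t) hqt h6 hstraight hled (βs t)).1, fun c hc => ?_⟩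
      · obtain ⟨δ, hmem, hm, hi, -, -⟩ :=
          exists_parent_of_mem_support_step_translate_u hji hju hjf hiu hif huf p (Bs t) hqt (βs t) hE
        have := h6 δ hmem
        exact ⟨by omega, by rw [← hi]; exact (hr1 δ hmem).2⟩
      · rw [coeff_flag_step_translate_u_sigma hji hju hjf hiu hif huf p hσ hd2 (Bs t) hqt (fun e he hef => (hled e he hef).1)
          (βs t) hc, hflag c hc]
    · have hcone : (Finsupp.single j n + Finsupp.single i n + Finsupp.single u 0 + Finsupp.single f d : Fin 4 →₀ ℕ) =
          Finsupp.single i n + Finsupp.single j n + Finsupp.single u 0 + Finsupp.single f d := gameExp_swap n n 0 d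
      have hstraight' : ∀ e ∈ (Bs t).F.support, e.degree = p + n →
          e = Finsupp.single i n + Finsupp.single j n + Finsupp.single u 0 + Finsupp.single f d := fun e he hd =>
        (hstraight e he hd).trans hcone
      have hled' : ∀ e ∈ (Bs t).F.support, e f ≤ d - 1 → n + 1 ≤ e i ∧ n + 1 ≤ e j := fun e he hef => (hled e he hef).symm
      refine ⟨fun E hE => ?_, fun e he hef =>
        ((ledger_degree_step_translate_u_sigma hji.symm hiu hif hju hjf huf p hd2 (Bs t) hqt h6 hstraight' hled' (βs t)).1
          e he hef).symm, fun c hc => ?_⟩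
      · obtain ⟨δ, hmem, hm, hj, -, -⟩ :=
          exists_parent_of_mem_support_step_translate_u hji.symm hiu hif hju hjf huf p (Bs t) hqt (βs t) hE
        have := h6 δ hmem
        exact ⟨by rw [← hj]; exact (hr1 δ hmem).1, by omega⟩
      · rw [gameExp_swap (n + 1) (n + 1) (d - 1 - c) c,
          coeff_flag_step_translate_u_sigma hji.symm hiu hif hju hjf huf p hσ hd2 (Bs t) hqt (fun e he hef => (hled e he hef).2)
            (βs t) hc, ← gameExp_swap (n + 1) (n + 1) (d - 1 - c) c, hflag c hc]

/-! ## 3. Killer exclusion from a later letter change -/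

/-- **NO σ-KILLER BEFORE A LETTER CHANGE** (module docstring §3): in a translated slot chain in regime, if the step at `t₀` is a `j`-step and some
later step changes letter (`ℓs t₁ ≠ ℓs (t₁ + 1)`, `t₀ < t₁`, `t₁ + 2 ≤ T`), then `Bs (t₀ + 1)` has no σ-`j`-killer
`x_j^{a} x_i^{n+1} x_u^{d+n−c−a} x_f^c` (`n + 2 ≤ a ≤ d + n − c`, `c + 2 ≤ d`). The `n = 1` case is FILE ♯8-chain's `chain_nokill_prime`. [OURS]
[cite: Hauser2010, §§F–G] -/
theorem chain_nokill_sigma (p : ℕ) {n d : ℕ} (hσ : n + d = p) (hd2 : 2 ≤ d)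
    (Bs : ℕ → State K) (ℓs : ℕ → Fin 4) (βs : ℕ → K) {T : ℕ}
    (hstep : ∀ t, t < T → Bs (t + 1) = CentreBlowup.step p Finset.univ (ℓs t) (Function.update (0 : Fin 4 → K) u (βs t)) (Bs t))
    (hℓ : ∀ t, ℓs t = j ∨ ℓs t = i)
    (hq : ∀ t, t ≤ T → ((p : ℕ) : ℕ∞) ≤ ordAlong Finset.univ (Bs t).F)
    (hreg : ∀ t, t ≤ T → ∀ E ∈ (Bs t).F.support,
      p + n + 1 ≤ E.degree ∨ E = Finsupp.single j n + Finsupp.single i n + Finsupp.single u 0 + Finsupp.single f d)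
    (hbase : ∀ t, t ≤ T →
      (∀ e ∈ (Bs t).F.support, e f ≤ d - 1 → n + 1 ≤ e j ∧ n + 1 ≤ e i) ∧
        (∀ c, c + 2 ≤ d →
          coeff (Finsupp.single j (n + 1) + Finsupp.single i (n + 1) + Finsupp.single u (d - 1 - c) + Finsupp.single f c)
            (Bs t).F = 0))
    {t₀ t₁ : ℕ} (h01 : t₀ < t₁) (ht₁ : t₁ + 2 ≤ T) (hch₁ : ℓs t₁ ≠ ℓs (t₁ + 1)) :
    ∀ a c : ℕ, n + 2 ≤ a → c + 2 ≤ d → a ≤ d + n - c →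
      coeff (Finsupp.single j a + Finsupp.single i (n + 1) + Finsupp.single u (d + n - c - a) + Finsupp.single f c)
        (Bs (t₀ + 1)).F = 0 := by
  intro a c ha hc hac
  by_contra hne
  obtain ⟨a', rfl⟩ : ∃ a', a = a' + 1 := ⟨a - 1, by omega⟩
  have hna' : n + 1 ≤ a' := by omega
  have hac' : a' ≤ d + n - 1 - c := by omega
  rw [show d + n - c - (a' + 1) = d + n - 1 - c - a' by omega] at hne
  -- a killer forbids the next `j`-step …
  have hletter : ∀ t, t + 1 ≤ T →
      coeff (Finsupp.single j (a' + 1) + Finsupp.single i (n + 1) + Finsupp.single u (d + n - 1 - c - a') + Finsupp.single f c)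
          (Bs t).F ≠ 0 →
        ℓs t = i := by
    intro t ht hk
    rcases hℓ t with hl | hl
    · exfalso
      obtain ⟨hled, hflag⟩ := hbase t (by omega)
      refine not_regime_step_translate_u_of_killer_sigma hji hju hjf hiu hif huf p hσ hd2 (Bs t) (hq t (by omega)) hled hna' hac'
        hc (hflag c hc) hk (βs t) ?_
      have h := hreg (t + 1) ht
      rw [hstep t (by omega), hl] at h
      exact h
    · exact hl
  -- … and survives the next `i`-step
  have hpersist : ∀ t, t + 1 ≤ T →
      coeff (Finsupp.single j (a' + 1) + Finsupp.single i (n + 1) + Finsupp.single u (d + n - 1 - c - a') + Finsupp.single f c)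
          (Bs t).F ≠ 0 →
        coeff (Finsupp.single j (a' + 1) + Finsupp.single i (n + 1) + Finsupp.single u (d + n - 1 - c - a') + Finsupp.single f c)
          (Bs (t + 1)).F ≠ 0 := by
    intro t ht hk
    have hl := hletter t ht hk
    obtain ⟨hled, -⟩ := hbase t (by omega)
    rw [hstep t (by omega), hl, coeff_killer_step_translate_other_sigma hji hju hjf hiu hif huf p hσ hd2 (Bs t) (hq t (by omega))
      hled hac' (by omega) (βs t)]
    exact hk
  have key : ∀ m, t₀ + 1 + m + 1 ≤ T →
      coeff (Finsupp.single j (a' + 1) + Finsupp.single i (n + 1) + Finsupp.single u (d + n - 1 - c - a') + Finsupp.single f c)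
        (Bs (t₀ + 1 + m)).F ≠ 0 := by
    intro m
    induction m with
    | zero => exact fun _ => hne
    | succ m ih => exact fun hT => hpersist (t₀ + 1 + m) (by omega) (ih (by omega))
  have h1 : ℓs t₁ = i := by
    refine hletter t₁ (by omega) ?_
    have h := key (t₁ - (t₀ + 1)) (by omega)
    rwa [show t₀ + 1 + (t₁ - (t₀ + 1)) = t₁ by omega] at h
  have h2 : ℓs (t₁ + 1) = i := by
    refine hletter (t₁ + 1) (by omega) ?_
    have h := key (t₁ + 1 - (t₀ + 1)) (by omega)
    rwa [show t₀ + 1 + (t₁ + 1 - (t₀ + 1)) = t₁ + 1 by omega] at h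
  exact hch₁ (h1.trans h2.symm)

/-! ## 4. The chain theorem -/

/-- **THE σ-♯-FRAME ALONG A TRANSLATED SLOT CHAIN, change at a `j`-step** (module docstring §4, case `ℓs t₀ = j`). [OURS]
[cite: Hauser2010, §§F–G] [cite: CossartJannsenSaito2020, Thm. 3.14] -/
theorem sharp_chain_sigma_of_eq (p : ℕ) {n d : ℕ} (hσ : n + d = p) (hd2 : 2 ≤ d)
    (Bs : ℕ → State K) (ℓs : ℕ → Fin 4) (βs : ℕ → K) {T : ℕ}
    (hstep : ∀ t, t < T → Bs (t + 1) = CentreBlowup.step p Finset.univ (ℓs t) (Function.update (0 : Fin 4 → K) u (βs t)) (Bs t))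
    (hℓ : ∀ t, ℓs t = j ∨ ℓs t = i)
    (hq : ∀ t, t ≤ T → ((p : ℕ) : ℕ∞) ≤ ordAlong Finset.univ (Bs t).F)
    (hreg : ∀ t, t ≤ T → ∀ E ∈ (Bs t).F.support,
      p + n + 1 ≤ E.degree ∨ E = Finsupp.single j n + Finsupp.single i n + Finsupp.single u 0 + Finsupp.single f d)
    (hr1₀ : ∀ e ∈ (Bs 0).F.support, n ≤ e j ∧ n ≤ e i)
    (hled₀ : ∀ e ∈ (Bs 0).F.support, e f ≤ d - 1 → n + 1 ≤ e j ∧ n + 1 ≤ e i)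
    (hflag₀ : ∀ c, c + 2 ≤ d →
      coeff (Finsupp.single j (n + 1) + Finsupp.single i (n + 1) + Finsupp.single u (d - 1 - c) + Finsupp.single f c) (Bs 0).F = 0)
    {t₀ t₁ : ℕ} (h01 : t₀ < t₁) (ht₁ : t₁ + 2 ≤ T) (hκ : ℓs t₀ = j) (hch₀ : ℓs t₀ ≠ ℓs (t₀ + 1))
    (hch₁ : ℓs t₁ ≠ ℓs (t₁ + 1)) :
    ∀ t, t₀ + 2 ≤ t → t + 1 ≤ T →
      (∀ e ∈ (Bs t).F.support, n ≤ e j ∧ n ≤ e i) ∧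
        (∀ e ∈ (Bs t).F.support, e f ≤ d - 1 → n + 1 ≤ e j ∧ n + 1 ≤ e i) ∧
        (∀ e ∈ (Bs t).F.support, e f + 2 ≤ d → n + 2 ≤ e j ∧ n + 2 ≤ e i) ∧
        (∀ E : Fin 4 →₀ ℕ, E.degree = p + n + 1 → E f + 2 ≤ d → coeff E (Bs t).F = 0) := by
  have hbase := chain_base_sigma hji hju hjf hiu hif huf p hσ hd2 Bs ℓs βs hstep hℓ hq hreg hr1₀ hled₀ hflag₀
  have ho : ℓs (t₀ + 1) = i := by
    rcases hℓ (t₀ + 1) with h | h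
    · exact absurd (hκ.trans h.symm) hch₀
    · exact h
  have hnokill := chain_nokill_sigma hji hju hjf hiu hif huf p hσ hd2 Bs ℓs βs hstep hℓ hq hreg
    (fun t ht => ⟨(hbase t ht).2.1, (hbase t ht).2.2⟩) h01 ht₁ hch₁
  -- the three steps after `t₀`
  have hS1 : Bs (t₀ + 1) = CentreBlowup.step p Finset.univ j (Function.update (0 : Fin 4 → K) u (βs t₀)) (Bs t₀) := by
    rw [hstep t₀ (by omega), hκ]
  have hS2 : Bs (t₀ + 2) = CentreBlowup.step p Finset.univ i (Function.update (0 : Fin 4 → K) u (βs (t₀ + 1))) (Bs (t₀ + 1)) := by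
    rw [hstep (t₀ + 1) (by omega), ho]
  have hS3 : Bs (t₀ + 3) =
      CentreBlowup.step p Finset.univ (ℓs (t₀ + 2)) (Function.update (0 : Fin 4 → K) u (βs (t₀ + 2))) (Bs (t₀ + 2)) :=
    hstep (t₀ + 2) (by omega)
  obtain ⟨hr1', hled', hflag'⟩ := hbase t₀ (by omega)
  have hstart := sharpEntry_start_sigma hji hju hjf hiu hif huf p hσ hd2 (Bs t₀) (hq t₀ (by omega)) hr1' (hreg t₀ (by omega))
    hled' hflag' (βs t₀) (by rw [← hS1]; exact hq (t₀ + 1) (by omega)) (by rw [← hS1]; exact hreg (t₀ + 1) (by omega))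
    (by rw [← hS1]; exact hnokill) (βs (t₀ + 1)) (by rw [← hS1, ← hS2]; exact hq (t₀ + 2) (by omega))
    (by rw [← hS1, ← hS2]; exact hreg (t₀ + 2) (by omega)) (hℓ (t₀ + 2)) (βs (t₀ + 2))
    (by rw [← hS1, ← hS2, ← hS3]; exact hreg (t₀ + 3) (by omega))
  rw [← hS1, ← hS2] at hstart
  -- induction along the chain
  have main : ∀ m, t₀ + 2 + m + 1 ≤ T →
      (∀ e ∈ (Bs (t₀ + 2 + m)).F.support, n ≤ e j ∧ n ≤ e i) ∧
        (∀ e ∈ (Bs (t₀ + 2 + m)).F.support, e f ≤ d - 1 → n + 1 ≤ e j ∧ n + 1 ≤ e i) ∧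
        (∀ e ∈ (Bs (t₀ + 2 + m)).F.support, e f + 2 ≤ d → n + 2 ≤ e j ∧ n + 2 ≤ e i) ∧
        (∀ E : Fin 4 →₀ ℕ, E.degree = p + n + 1 → E f + 2 ≤ d → coeff E (Bs (t₀ + 2 + m)).F = 0) := by
    intro m
    induction m with
    | zero => exact fun _ => hstart
    | succ m ih =>
      intro hT
      obtain ⟨hr1, hled, hR, hlayer⟩ := ih (by omega)
      have hc1 : Bs (t₀ + 2 + m + 1) = CentreBlowup.step p Finset.univ (ℓs (t₀ + 2 + m))
          (Function.update (0 : Fin 4 → K) u (βs (t₀ + 2 + m))) (Bs (t₀ + 2 + m)) := hstep (t₀ + 2 + m) (by omega)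
      have hc2 : Bs (t₀ + 2 + m + 2) = CentreBlowup.step p Finset.univ (ℓs (t₀ + 2 + m + 1))
          (Function.update (0 : Fin 4 → K) u (βs (t₀ + 2 + m + 1))) (Bs (t₀ + 2 + m + 1)) := hstep (t₀ + 2 + m + 1) (by omega)
      have H := sharpEntry_step_either_sigma hji hju hjf hiu hif huf p hσ hd2 (Bs (t₀ + 2 + m)) (hq (t₀ + 2 + m) (by omega)) hr1
        (hreg (t₀ + 2 + m) (by omega)) hled hR hlayer (hℓ (t₀ + 2 + m)) (βs (t₀ + 2 + m))
        (by rw [← hc1]; exact hq (t₀ + 2 + m + 1) (by omega))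
        (hℓ (t₀ + 2 + m + 1)) (βs (t₀ + 2 + m + 1)) (by rw [← hc1, ← hc2]; exact hreg (t₀ + 2 + m + 2) (by omega))
      rw [← hc1] at H
      exact H
  intro t ht htT
  have hpk := main (t - (t₀ + 2)) (by omega)
  rw [show t₀ + 2 + (t - (t₀ + 2)) = t by omega] at hpk
  exact hpk

/-- **THE σ-♯-FRAME ALONG A TRANSLATED SLOT CHAIN** (module docstring §4): in a translated slot chain in regime whose initial state has SLOTS,
the σ-ledger and no σ-flag row, with a letter change at `t₀` and another at `t₁ > t₀` (`t₁ + 2 ≤ T`), every state `Bs t` with `t₀ + 2 ≤ t`,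
`t + 1 ≤ T` has SLOTS, the σ-ledger, REGIME R and LAYER.  The state-level half of E5σ♭; the `n = 1` case is FILE ♯8-chain's
`sharp_chain_prime` minus its ♯-flag conjunct. [OURS] [cite: Hauser2010, §§F–G] [cite: CossartJannsenSaito2020, Thm. 3.14] -/
theorem sharp_chain_sigma (p : ℕ) {n d : ℕ} (hσ : n + d = p) (hd2 : 2 ≤ d)
    (Bs : ℕ → State K) (ℓs : ℕ → Fin 4) (βs : ℕ → K) {T : ℕ}
    (hstep : ∀ t, t < T → Bs (t + 1) = CentreBlowup.step p Finset.univ (ℓs t) (Function.update (0 : Fin 4 → K) u (βs t)) (Bs t))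
    (hℓ : ∀ t, ℓs t = j ∨ ℓs t = i)
    (hq : ∀ t, t ≤ T → ((p : ℕ) : ℕ∞) ≤ ordAlong Finset.univ (Bs t).F)
    (hreg : ∀ t, t ≤ T → ∀ E ∈ (Bs t).F.support,
      p + n + 1 ≤ E.degree ∨ E = Finsupp.single j n + Finsupp.single i n + Finsupp.single u 0 + Finsupp.single f d)
    (hr1₀ : ∀ e ∈ (Bs 0).F.support, n ≤ e j ∧ n ≤ e i)
    (hled₀ : ∀ e ∈ (Bs 0).F.support, e f ≤ d - 1 → n + 1 ≤ e j ∧ n + 1 ≤ e i)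
    (hflag₀ : ∀ c, c + 2 ≤ d →
      coeff (Finsupp.single j (n + 1) + Finsupp.single i (n + 1) + Finsupp.single u (d - 1 - c) + Finsupp.single f c) (Bs 0).F = 0)
    {t₀ t₁ : ℕ} (h01 : t₀ < t₁) (ht₁ : t₁ + 2 ≤ T) (hch₀ : ℓs t₀ ≠ ℓs (t₀ + 1)) (hch₁ : ℓs t₁ ≠ ℓs (t₁ + 1)) :
    ∀ t, t₀ + 2 ≤ t → t + 1 ≤ T →
      (∀ e ∈ (Bs t).F.support, n ≤ e j ∧ n ≤ e i) ∧
        (∀ e ∈ (Bs t).F.support, e f ≤ d - 1 → n + 1 ≤ e j ∧ n + 1 ≤ e i) ∧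
        (∀ e ∈ (Bs t).F.support, e f + 2 ≤ d → n + 2 ≤ e j ∧ n + 2 ≤ e i) ∧
        (∀ E : Fin 4 →₀ ℕ, E.degree = p + n + 1 → E f + 2 ≤ d → coeff E (Bs t).F = 0) := by
  rcases hℓ t₀ with hκ | hκ
  · exact sharp_chain_sigma_of_eq hji hju hjf hiu hif huf p hσ hd2 Bs ℓs βs hstep hℓ hq hreg hr1₀ hled₀ hflag₀ h01 ht₁ hκ hch₀ hch₁
  · have hcone : (Finsupp.single j n + Finsupp.single i n + Finsupp.single u 0 + Finsupp.single f d : Fin 4 →₀ ℕ) =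
        Finsupp.single i n + Finsupp.single j n + Finsupp.single u 0 + Finsupp.single f d := gameExp_swap n n 0 d
    have H := sharp_chain_sigma_of_eq hji.symm hiu hif hju hjf huf p hσ hd2 Bs ℓs βs hstep (fun t => (hℓ t).symm) hq
      (fun t ht E hE => (hreg t ht E hE).imp_right fun h => h.trans hcone) (fun e he => (hr1₀ e he).symm)
      (fun e he hef => (hled₀ e he hef).symm)
      (fun c hc => by rw [← gameExp_swap (n + 1) (n + 1) (d - 1 - c) c]; exact hflag₀ c hc) h01 ht₁ hκ hch₀ hch₁
    intro t ht htT
    obtain ⟨h1, h2, h3, h4⟩ := H t ht htT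
    exact ⟨fun e he => (h1 e he).symm, fun e he hef => (h2 e he hef).symm, fun e he hef => (h3 e he hef).symm, h4⟩

end Chain

end ResCone

end Summit.ResolutionOfSingularities.ResolutionOfSingularities.Theorems.PIDim4
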